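import Summits.NavierStokesRegularity.NavierStokesRegularity.Theorems.CircuitPump.Negative.LoadBearing

/-!
# Truncation limit: relative periodic orbits of the truncated lattices ⇒ one of the full lattice
# (crux `PerpetualPump.CircuitPump`, stmt-NavierStokesRegularity-1834;
# line `singular-clock-gspt`, stub D `stub_truncationLimit`)

For Tao's viscous circuit `rhsF` (`Theorems/CircuitPump/Negative/LoadBearing.lean`): if at
arbitrarily high truncation level `L` (modes `|n| > L` frozen at `0`) the `L`-truncated lattice
has a relative periodic point — a box datum, a flight time `T ∈ [Tmin, Tmax]`, the truncated
solution `Z` on `[0, Tmax]` with the UNIFORM weighted bound `lam^{3n/5} |Z_{i,n}(t)| ≤ C` and the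
matching `Z_{i,n}(0) = lam^{1/5} Z_{i,n+1}(T)` on `|n| ≤ L` — then the FULL lattice has a
one-period relative periodic orbit on `[0, Tmax]` in the same box with the same bound
(`stub_truncationLimit`).

Proof. The value of `rhsF` at time `t` is a fixed polynomial in finitely many coordinates of the
time-`t` slice of the state (`rhsF_slice`, `rhsF_continuous_slice`), hence bounded on the a priori
box (`rhsF_slice_bound`, Tychonoff); so the coordinates `Z_{i,n}` of the truncated solutions are
uniformly bounded and equi-Lipschitz on `[0, Tmax]` (mean value inequality; the frozen modes are
`0`). The generic extraction `equiLipschitz_subseq` (Arzelà–Ascoli in each of the countably many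
coordinates, Tychonoff in the countable product of function spaces, first countability, and
compactness of the flight-time window) gives a subsequence converging uniformly in every
coordinate together with the flight times. The integral form of the equations passes to the
limit (dominated convergence, finitely many coordinates enter each equation), so the limit solves
the full system on `[0, Tmax]` (FTC within `Icc`); the weighted bound, the closed box conditions
and the matching identity pass to the limit (joint continuity of evaluation). [folklore]
-/

noncomputable section

-- the summit namespace `…NavierStokesRegularity.NavierStokesRegularity…` is the tree convention
set_option linter.dupNamespace false

namespace Summit.NavierStokesRegularity.NavierStokesRegularity.Theorems.PerpetualPumpCircuitPump

open Set Metric Filter Topology MeasureTheory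
open scoped NNReal BoundedContinuousFunction Interval
open Summit.NavierStokesRegularity.NavierStokesRegularity.Theorems.CircuitPumpNegative

variable {m : ℕ}

/-- The right-hand side `rhsF` at time `t` only depends on the time-`t` slice of the state. -/
theorem rhsF_slice (lam : ℝ) (coeff : Fin m → Fin m → Fin m → Option (Fin 3) → ℝ)
    (X : Fin m → ℤ → ℝ → ℝ) (i : Fin m) (n : ℤ) (t : ℝ) :
    rhsF lam coeff X i n t = rhsF lam coeff (fun i' n' _ => X i' n' t) i n 0 := rfl

/-- The slice map `v ↦ rhsF (v)` is continuous for the product topology (a polynomial in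
finitely many coordinates). -/
theorem rhsF_continuous_slice (lam : ℝ)
    (coeff : Fin m → Fin m → Fin m → Option (Fin 3) → ℝ) (i : Fin m) (n : ℤ) :
    Continuous fun v : Fin m → ℤ → ℝ => rhsF lam coeff (fun i' n' _ => v i' n') i n 0 := by
  unfold rhsF
  fun_prop

/-- The slice map is bounded on every box `|v i' n'| ≤ b n'` (continuity + Tychonoff). -/
theorem rhsF_slice_bound (lam : ℝ) (coeff : Fin m → Fin m → Fin m → Option (Fin 3) → ℝ)
    (b : ℤ → ℝ) (i : Fin m) (n : ℤ) :
    ∃ M : ℝ≥0, ∀ v : Fin m → ℤ → ℝ, (∀ i' n', |v i' n'| ≤ b n') →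
      |rhsF lam coeff (fun i' n' _ => v i' n') i n 0| ≤ M := by
  obtain ⟨M, hM⟩ := (isCompact_univ_pi fun (_ : Fin m) =>
      isCompact_univ_pi fun n' : ℤ => (isCompact_Icc : IsCompact (Icc (-b n') (b n'))))
    |>.exists_bound_of_continuousOn (rhsF_continuous_slice lam coeff i n).continuousOn
  refine ⟨M.toNNReal, fun v hv => le_trans ?_ (Real.le_coe_toNNReal M)⟩
  have := hM v (Set.mem_univ_pi.2 fun i' => Set.mem_univ_pi.2 fun n' => abs_le.1 (hv i' n'))
  simpa only [Real.norm_eq_abs] using this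

/-- **Equi-Lipschitz extraction with a parameter.** A sequence `f k` of families, indexed by
a countable set, of functions uniformly bounded (`|f k p| ≤ B p`) and equi-Lipschitz (constant
`K p`) on `[a, b]`, together with parameters `T k ∈ [T₁, T₂]`, has a subsequence along which
the parameters converge in `[T₁, T₂]` and every coordinate converges uniformly on `[a, b]` —
stated as convergence of `f (φ k) p (u k)` whenever `u k → x` in `[a, b]` — to continuous
limits obeying the same bounds (Arzelà–Ascoli in each coordinate, Tychonoff in the countable
product, first countability). [folklore] -/
theorem equiLipschitz_subseq {ι : Type*} [Countable ι] {a b : ℝ} (hab : a ≤ b) {T₁ T₂ : ℝ}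
    (B : ι → ℝ) (K : ι → ℝ≥0) (f : ℕ → ι → ℝ → ℝ) (T : ℕ → ℝ)
    (hT : ∀ k, T k ∈ Icc T₁ T₂) (hB : ∀ k p, ∀ x ∈ Icc a b, |f k p x| ≤ B p)
    (hK : ∀ k p, LipschitzOnWith (K p) (f k p) (Icc a b)) :
    ∃ (g : ι → ℝ → ℝ) (T' : ℝ) (φ : ℕ → ℕ), T' ∈ Icc T₁ T₂ ∧ StrictMono φ ∧
      Tendsto (fun k => T (φ k)) atTop (𝓝 T') ∧ (∀ p, Continuous (g p)) ∧
      (∀ p, ∀ x ∈ Icc a b, |g p x| ≤ B p) ∧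
      ∀ p (u : ℕ → ℝ) (x : ℝ), (∀ k, u k ∈ Icc a b) → Tendsto u atTop (𝓝 x) →
        Tendsto (fun k => f (φ k) p (u k)) atTop (𝓝 (g p x)) := by
  have hc : ∀ k p, Continuous ((Icc a b).restrict (f k p)) := fun k p =>
    continuousOn_iff_continuous_restrict.1 (hK k p).continuousOn
  -- the sequence, in a countable product of function spaces
  set F : ℕ → (ι → (Icc a b →ᵇ ℝ)) × ℝ := fun k =>
    (fun p => BoundedContinuousFunction.mkOfCompact ⟨_, hc k p⟩, T k)
  -- the compact set it lives in
  set A : ι → Set (Icc a b →ᵇ ℝ) := fun p =>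
    {h | ∀ x y, |h x| ≤ B p ∧ dist (h x) (h y) ≤ K p * dist x y} with hA
  have hAc : ∀ p, IsCompact (A p) := fun p => by
    refine BoundedContinuousFunction.arzela_ascoli₂ (Icc (-B p) (B p)) isCompact_Icc (A p) ?_
      (fun h x hh => abs_le.1 (hh x x).1) ?_
    · simp only [hA, setOf_forall, setOf_and]
      exact isClosed_iInter fun x => isClosed_iInter fun y =>
        (isClosed_le (by fun_prop) continuous_const).inter
          (isClosed_le (by fun_prop) (by fun_prop))
    · exact Metric.equicontinuous_of_continuity_modulus (fun d => K p * d)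
        ((continuous_const.mul continuous_id).tendsto' _ _ (mul_zero _)) _
        fun x y h => (h.2 x y).2
  have hS : IsCompact ((univ.pi fun p => A p) ×ˢ Icc T₁ T₂) :=
    (isCompact_univ_pi hAc).prod isCompact_Icc
  have hFS : ∀ k, F k ∈ (univ.pi fun p => A p) ×ˢ Icc T₁ T₂ := fun k => mk_mem_prod
    (mem_univ_pi.2 fun p x y => ⟨hB k p x x.2, (hK k p).dist_le_mul x x.2 y y.2⟩) (hT k)
  obtain ⟨⟨G, T'⟩, ⟨hGA, hT'⟩, φ, hφ, hlim⟩ := hS.tendsto_subseq hFS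
  have hGA' : ∀ p, G p ∈ A p := fun p => (mem_univ_pi.1 hGA) p
  have h1 : Tendsto (fun k => (F (φ k)).1) atTop (𝓝 G) := (continuous_fst.tendsto _).comp hlim
  refine ⟨fun p x => G p (projIcc a b hab x), T', φ, hT', hφ,
    (continuous_snd.tendsto _).comp hlim, fun p => (G p).continuous.comp continuous_projIcc,
    fun p x hx => by simpa only [projIcc_of_mem hab hx] using (hGA' p ⟨x, hx⟩ ⟨x, hx⟩).1,
    fun p u x hu hux => ?_⟩
  have := (tendsto_pi_nhds.1 h1 p).eval ((continuous_projIcc (h := hab)).tendsto x |>.comp hux)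
  refine this.congr fun k => ?_
  show f (φ k) p (projIcc a b hab (u k)) = f (φ k) p (u k)
  rw [projIcc_of_mem hab (hu k)]

/-- **Stub D (`TruncationLimit`).** From relative periodic points of the `L`-truncated lattices at
arbitrarily high level `L` (uniform weighted bound `C`, flight times in `[Tmin, Tmax]`, compact
sections), a one-period relative periodic orbit of the FULL lattice on `[0, Tmax]`: equi-Lipschitz
compactness + diagonal subsequence (`equiLipschitz_subseq`) + passage to the limit in the integral
form of the equations. [folklore] -/
theorem stub_truncationLimit :
    ∀ (lam : ℝ), 1 < lam → ∀ (m : ℕ) (coeff : Fin m → Fin m → Fin m → Option (Fin 3) → ℝ)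
    (lo hi : Fin m → ℝ) (Q : ℤ → Set (Fin m → ℝ)) (C Tmin Tmax : ℝ),
    0 < Tmin → Tmin ≤ Tmax → (∀ n : ℤ, n ≠ 0 → IsCompact (Q n)) →
    (∀ L₀ : ℕ, ∃ L : ℕ, L₀ ≤ L ∧ ∃ (x : Fin m → ℤ → ℝ) (T : ℝ) (Z : Fin m → ℤ → ℝ → ℝ),
        ((∀ i : Fin m, lo i ≤ x i 0 ∧ x i 0 ≤ hi i) ∧ ∀ n : ℤ, n ≠ 0 → (fun i => x i n) ∈ Q n) ∧
        T ∈ Set.Icc Tmin Tmax ∧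
        ((∀ (i : Fin m) (n : ℤ), Z i n 0 = x i n) ∧
          (∀ (i : Fin m) (n : ℤ), (L : ℤ) < |n| → ∀ t ∈ Set.Icc (0 : ℝ) Tmax, Z i n t = 0) ∧
          (∀ (i : Fin m) (n : ℤ), |n| ≤ (L : ℤ) → ∀ t ∈ Set.Icc (0 : ℝ) Tmax,
            HasDerivWithinAt (Z i n)
              (Summit.NavierStokesRegularity.NavierStokesRegularity.Theorems.CircuitPumpNegative.rhsF
                lam coeff Z i n t) (Set.Icc (0 : ℝ) Tmax) t)) ∧
        (∀ (i : Fin m) (n : ℤ), ∀ t ∈ Set.Icc (0 : ℝ) Tmax, lam ^ ((3 / 5 : ℝ) * n) * |Z i n t| ≤ C) ∧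
        ∀ (i : Fin m) (n : ℤ), |n| ≤ (L : ℤ) → x i n = lam ^ (1 / 5 : ℝ) * Z i (n + 1) T) →
    ∃ (T : ℝ) (Z : Fin m → ℤ → ℝ → ℝ), T ∈ Set.Icc Tmin Tmax ∧
      (∀ (i : Fin m) (n : ℤ), ∀ t ∈ Set.Icc (0 : ℝ) Tmax,
        HasDerivWithinAt (Z i n)
          (Summit.NavierStokesRegularity.NavierStokesRegularity.Theorems.CircuitPumpNegative.rhsF
            lam coeff Z i n t) (Set.Icc (0 : ℝ) Tmax) t) ∧
      (∀ (i : Fin m) (n : ℤ), ∀ t ∈ Set.Icc (0 : ℝ) Tmax, lam ^ ((3 / 5 : ℝ) * n) * |Z i n t| ≤ C) ∧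
      ((∀ i : Fin m, lo i ≤ Z i 0 0 ∧ Z i 0 0 ≤ hi i) ∧ ∀ n : ℤ, n ≠ 0 → (fun i => Z i n 0) ∈ Q n) ∧
      ∀ (i : Fin m) (n : ℤ), Z i n 0 = lam ^ (1 / 5 : ℝ) * Z i (n + 1) T := by
  intro lam hlam m coeff lo hi Q C Tmin Tmax hTmin hTminmax hQ H
  -- data at levels `L k ≥ k`
  choose L hLk x T Z hbox hT hsol hW hmatch using H
  have hZ0 : ∀ k i n, Z k i n 0 = x k i n := fun k => (hsol k).1
  have hzero := fun k => (hsol k).2.1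
  have hD := fun k => (hsol k).2.2
  have hlam0 : 0 < lam := one_pos.trans hlam
  have h0T : (0 : ℝ) ≤ Tmax := hTmin.le.trans hTminmax
  have h0I : (0 : ℝ) ∈ Icc 0 Tmax := ⟨le_rfl, h0T⟩
  have hTI : ∀ k, T k ∈ Icc 0 Tmax := fun k => ⟨hTmin.le.trans (hT k).1, (hT k).2⟩
  -- the a priori box
  have hpow : ∀ n : ℤ, 0 < lam ^ ((3 / 5 : ℝ) * n) := fun n => Real.rpow_pos_of_pos hlam0 _
  set b : ℤ → ℝ := fun n => C / lam ^ ((3 / 5 : ℝ) * n) with hb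
  have hZb : ∀ k (p : Fin m × ℤ), ∀ t ∈ Icc (0 : ℝ) Tmax, |Z k p.1 p.2 t| ≤ b p.2 :=
    fun k p t ht => (le_div_iff₀ (hpow p.2)).2 (by rw [mul_comm]; exact hW k p.1 p.2 t ht)
  -- uniform derivative bounds and equi-Lipschitz estimates
  choose M hM using fun p : Fin m × ℤ => rhsF_slice_bound lam coeff b p.1 p.2
  have hLip : ∀ k (p : Fin m × ℤ), LipschitzOnWith (M p) (Z k p.1 p.2) (Icc 0 Tmax) := by
    intro k p
    rcases le_or_gt |p.2| (L k : ℤ) with hle | hlt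
    · refine (convex_Icc 0 Tmax).lipschitzOnWith_of_nnnorm_hasDerivWithin_le
        (fun t ht => hD k p.1 p.2 hle t ht) fun t ht => ?_
      rw [← NNReal.coe_le_coe, coe_nnnorm, Real.norm_eq_abs, rhsF_slice]
      exact hM p _ fun i' n' => hZb k (i', n') t ht
    · intro s hs t ht
      simp [hzero k p.1 p.2 hlt s hs, hzero k p.1 p.2 hlt t ht]
  have hcZ : ∀ k i n, ContinuousOn (Z k i n) (Icc 0 Tmax) := fun k i n =>
    (hLip k (i, n)).continuousOn
  -- extraction of a subsequence converging in every coordinate, with the flight times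
  obtain ⟨g, T', φ, hT', hφ, hTφ, hgc, hgb, hlim⟩ := equiLipschitz_subseq (ι := Fin m × ℤ)
    h0T (fun p => b p.2) M (fun k p => Z k p.1 p.2) T hT hZb hLip
  have hpt : ∀ i n, ∀ t ∈ Icc (0 : ℝ) Tmax,
      Tendsto (fun k => Z (φ k) i n t) atTop (𝓝 (g (i, n) t)) :=
    fun i n t ht => hlim (i, n) (fun _ => t) t (fun _ => ht) tendsto_const_nhds
  have hslice : ∀ t ∈ Icc (0 : ℝ) Tmax, Tendsto (fun k => fun i' n' => Z (φ k) i' n' t) atTop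
      (𝓝 fun i' n' => g (i', n') t) :=
    fun t ht => tendsto_pi_nhds.2 fun i' => tendsto_pi_nhds.2 fun n' => hpt i' n' t ht
  -- along the subsequence the level eventually exceeds any `|n|`
  have hev : ∀ n : ℤ, ∀ᶠ k in atTop, |n| ≤ (L (φ k) : ℤ) := fun n =>
    eventually_atTop.2 ⟨n.natAbs, fun k hk => by
      rw [Int.abs_eq_natAbs]
      exact_mod_cast hk.trans ((hφ.id_le k).trans (hLk (φ k)))⟩
  refine ⟨T', fun i n => g (i, n), hT', fun i n t ht => ?_, fun i n t ht => ?_,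
    ⟨fun i => ⟨?_, ?_⟩, fun n hn => ?_⟩, fun i n => ?_⟩
  · -- the equations, through their integral form
    have hFk : ∀ k, ContinuousOn (fun s => rhsF lam coeff (Z k) i n s) (Icc 0 Tmax) := fun k =>
      (rhsF_continuous_slice lam coeff i n).comp_continuousOn
        (continuousOn_pi.2 fun i' => continuousOn_pi.2 fun n' => hcZ k i' n')
    have hFl : Continuous fun s => rhsF lam coeff (fun i' n' => g (i', n')) i n s :=
      (rhsF_continuous_slice lam coeff i n).comp
        (continuous_pi fun i' => continuous_pi fun n' => hgc (i', n'))
    have hint : ∀ k, |n| ≤ (L (φ k) : ℤ) → ∀ u ∈ Icc (0 : ℝ) Tmax, Z (φ k) i n u =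
        Z (φ k) i n 0 + ∫ s in (0 : ℝ)..u, rhsF lam coeff (Z (φ k)) i n s := by
      intro k hk u hu
      have := intervalIntegral.integral_eq_sub_of_hasDeriv_right_of_le hu.1
        ((hcZ (φ k) i n).mono (Icc_subset_Icc_right hu.2))
        (fun s hs => ((hD (φ k) i n hk s ⟨hs.1.le, hs.2.le.trans hu.2⟩).hasDerivAt
          (Icc_mem_nhds hs.1 (hs.2.trans_le hu.2))).hasDerivWithinAt)
        (((hFk (φ k)).mono (Icc_subset_Icc_right hu.2)).intervalIntegrable_of_Icc hu.1)
      linarith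
    have hintl : ∀ u ∈ Icc (0 : ℝ) Tmax, g (i, n) u =
        g (i, n) 0 + ∫ s in (0 : ℝ)..u, rhsF lam coeff (fun i' n' => g (i', n')) i n s := by
      intro u hu
      have hsub : Ι (0 : ℝ) u ⊆ Icc 0 Tmax := by
        rw [uIoc_of_le hu.1]
        exact fun s hs => ⟨hs.1.le, hs.2.trans hu.2⟩
      refine tendsto_nhds_unique_of_eventuallyEq (hpt i n u hu) ((hpt i n 0 h0I).add ?_)
        ((hev n).mono fun k hk => hint k hk u hu)
      refine intervalIntegral.tendsto_integral_filter_of_dominated_convergence (fun _ => M (i, n))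
        (Eventually.of_forall fun k =>
          ((hFk (φ k)).mono hsub).aestronglyMeasurable measurableSet_uIoc)
        (Eventually.of_forall fun k => ae_of_all _ fun s hs => ?_) intervalIntegrable_const
        (ae_of_all _ fun s hs => ?_)
      · rw [Real.norm_eq_abs, rhsF_slice]
        exact hM (i, n) _ fun i' n' => hZb (φ k) (i', n') s (hsub hs)
      · exact ((rhsF_continuous_slice lam coeff i n).tendsto _).comp (hslice s (hsub hs))
    haveI : Fact (t ∈ Icc (0 : ℝ) Tmax) := ⟨ht⟩
    have hder := intervalIntegral.integral_hasDerivWithinAt_right (a := 0) (b := t)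
      (s := Icc (0 : ℝ) Tmax) (t := Icc (0 : ℝ) Tmax) (hFl.intervalIntegrable _ _)
      (hFl.stronglyMeasurableAtFilter _ _) hFl.continuousWithinAt
    exact (hder.const_add (g (i, n) 0)).congr_of_mem (fun u hu => hintl u hu) ht
  · -- the weighted bound
    rw [mul_comm]
    exact (le_div_iff₀ (hpow n)).1 (hgb (i, n) t ht)
  · -- the box at the active scale
    exact ge_of_tendsto' (hpt i 0 0 h0I) fun k => by rw [hZ0]; exact ((hbox (φ k)).1 i).1
  · exact le_of_tendsto' (hpt i 0 0 h0I) fun k => by rw [hZ0]; exact ((hbox (φ k)).1 i).2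
  · -- the compact sections
    refine (hQ n hn).isClosed.mem_of_tendsto (tendsto_pi_nhds.2 fun i => hpt i n 0 h0I)
      (Eventually.of_forall fun k => ?_)
    simp only [hZ0]
    exact (hbox (φ k)).2 n hn
  · -- the matching identity
    refine tendsto_nhds_unique_of_eventuallyEq (hpt i n 0 h0I)
      ((hlim (i, n + 1) (fun k => T (φ k)) T' (fun k => hTI (φ k)) hTφ).const_mul _)
      ((hev n).mono fun k hk => ?_)
    show Z (φ k) i n 0 = lam ^ (1 / 5 : ℝ) * Z (φ k) i (n + 1) (T (φ k))
    rw [hZ0, hmatch (φ k) i n hk]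

end Summit.NavierStokesRegularity.NavierStokesRegularity.Theorems.PerpetualPumpCircuitPump
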